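import Summits.MatrixMultiplication.MatrixMultiplication.Theorems.FarEdgeDescentSignTwistCommPow
import Literature.Computability.AlgebraicComplexity.ApproxDecompositionCertificate
import Literature.Computability.AlgebraicComplexity.KoszulYoungCertificate
import Literature.Computability.AlgebraicComplexity.BorderRankMatMulSmall
import Literature.Computability.AlgebraicComplexity.BorderRankMatMulThreeHalvesAllFields
import HarnessLib

/-!
# `R̲(𝔖^ᵀ) = R̲(𝔖^♭ᵀ) = 6`: the generic twists of `⟨2,2,2⟩` are BORDER-CHEAPER than `⟨2,2,2⟩`

Route `FarEdgeDescent` (cell `decomp-mm`, lens 2 «structural dichotomy (special vs generic)»,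
gen 32), Kernel VII; support for the aside `SubLogRate` (stmt-MatrixMultiplication-25371).

The twisted star `𝔖^ᵀ = twistedStar K 2 1` is the bilinear map `(X; y, y') ↦ (Xy, Xᵀy')` and the
flat-transpose star `𝔖^♭ᵀ = signTStar K` is `(X; y, y') ↦ (Xy, (X^♭)ᵀy')`; both are quantum twins
of `⟨2,2,2⟩ : (X; y, y') ↦ (Xy, Xy')` (`FarEdgeDescentTwistQuantumTwin`) and neither degenerates
to or from it (`FarEdgeDescentGenericAntichain`).  This file computes their BORDER RANK exactly,
over every field:

* `algBorderRank_twistedStar_le`, `algBorderRank_signTStar_le`: `R̲ ≤ 6` over every field, by a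
  kernel-checked order-`1` approximate decomposition with SIX triads
  (`ApproxCert.check`): writing `𝔖^ᵀ = ∑_{i,k} X_{ik} ⊗ (a_i ⊗ c'_k + a'_k ⊗ c_i)` (`a, c` the
  left leaves, `a', c'` the right leaves),
  `ε 𝔖^ᵀ + O(ε²) = ∑_{i,k} X_{ik} ⊗ (a_i + ε a'_k) ⊗ (c_i… ` — precisely
  `∑_{i,k} (a_i + ε a'_k) ⊗ X_{ik} ⊗ (c'_i + ε c_k) - ∑_i a_i ⊗ (X_{i0} + X_{i1}) ⊗ c'_i`,
  whose `ε⁰`-part cancels because the garbage `∑_{i,k} X_{ik} a_i c'_i` has rank `2`, not `4`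
  (for `⟨2,2,2⟩` the same ansatz leaves the rank-`4` garbage `∑ X_{ik} a_i c'_k`, and indeed
  `R̲(⟨2,2,2⟩) = 7`, Landsberg 2006);
* `six_le_algBorderRank_twistedStar`, `six_le_algBorderRank_signTStar`: `6 ≤ R̲` over every
  field, by a kernel-checked unit-pivot row certificate for the `p = 1` Koszul–Young flattening
  (Landsberg–Ottaviani), which has full rank `12 > 2 · 5` (`KYCert`);
* hence `algBorderRank_twistedStar`, `algBorderRank_signTStar`: **`R̲(𝔖^ᵀ) = R̲(𝔖^♭ᵀ) = 6`**,
  while `6 ≤ R̲(⟨2,2,2⟩)` over every field (tree) and `R̲(⟨2,2,2⟩) = 7` over `ℂ` (Landsberg 2006,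
  the named fact `Landsberg2005_borderRank_matMulTensor_two`): `algBorderRank_twists_lt_matMul`.
  Transposing ONE of the two products `Xy, Xy'` saves a multiplication in the border sense.

For the line: border rank is the first classical invariant found to DISTINGUISH the generic stratum
`{𝔖^ᵀ, 𝔖^♭ᵀ}` (border rank `6`) from the special stratum `⟨2,2,2⟩` (border rank `7`) at `N = 1` —
the quantum functionals, flattening ranks (`4,4,4`) and slice-rank data all agree on the four
tensors; since border rank does not increase under degeneration this is a second, elementary proof
of `𝔖^ᵀ, 𝔖^♭ᵀ ⋭ ⟨2,2,2⟩` over `ℂ` (in tree unconditionally via image / determinant classes).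

References: J. M. Landsberg, G. Ottaviani, Theory of Computing 11 (2015), Thm. 2.1
[LandsbergOttaviani2015]; M. Bläser, *Fast Matrix Multiplication* (2013), Def. 6.1 [Blaser2013];
J. M. Landsberg, J. Amer. Math. Soc. 19 (2006) [Landsberg2005]; P. Bürgisser, M. Clausen,
M. A. Shokrollahi, *Algebraic Complexity Theory* (1997), §15.4, Problem 15.1
[BurgisserClausenShokrollahi1997].
-/

noncomputable section

open scoped BigOperators

set_option linter.dupNamespace false

namespace Summit.MatrixMultiplication.MatrixMultiplication.Theorems.FarEdgeDescentTwistBorderRank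

open Literature.Computability.AlgebraicComplexity
open Literature.LinearAlgebra.Matrix
open Summit.MatrixMultiplication.MatrixMultiplication.Theorems.FarEdgeDescentTwistedStar
open Summit.MatrixMultiplication.MatrixMultiplication.Theorems.FarEdgeDescentSignTwist
open Summit.MatrixMultiplication.MatrixMultiplication.Theorems.FarEdgeDescentSignTwistDet
open Summit.MatrixMultiplication.MatrixMultiplication.Theorems.FarEdgeDescentSignTwistCommPow

universe u

/-! ## Integer data: the two tensors, the approximate decompositions, the Koszul certificates -/

/-- `𝔖^ᵀ` as an integer `4 × 4 × 4` table: leaves `inl i ↦ i`, `inr i ↦ 2 + i`; `x = (x₁,x₂) ↦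
2x₁ + x₂`; entries `(i, (i,k), k)` (left block) and `(2+k, (i,k), 2+i)` (right block).
[folklore] -/
def twistZ : Fin 4 → Fin 4 → Fin 4 → ℤ :=
  ApproxCert.ofEntries 4 4 4 [((0, 0, 0), 1), ((0, 1, 1), 1), ((1, 2, 0), 1), ((1, 3, 1), 1),
    ((2, 0, 2), 1), ((3, 1, 2), 1), ((2, 2, 3), 1), ((3, 3, 3), 1)]

/-- `𝔖^♭ᵀ` as an integer table: as `twistZ` with the sign `-1` at the right-block entry of
`x = (1,0)`. [folklore] -/
def flatTZ : Fin 4 → Fin 4 → Fin 4 → ℤ :=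
  ApproxCert.ofEntries 4 4 4 [((0, 0, 0), 1), ((0, 1, 1), 1), ((1, 2, 0), 1), ((1, 3, 1), 1),
    ((2, 0, 2), 1), ((3, 1, 2), 1), ((2, 2, 3), -1), ((3, 3, 3), 1)]

/-- First factors of the six triads for `𝔖^ᵀ`: `a_i + ε a'_k` (`ρ = 2i+k`), `-a_i` (`ρ = 4+i`).
[folklore] -/
def uT : Fin 6 → Fin 4 → List ℤ :=
  ![![[1], [], [0, 1], []], ![[1], [], [], [0, 1]], ![[], [1], [0, 1], []], ![[], [1], [], [0, 1]],
    ![[-1], [], [], []], ![[], [-1], [], []]]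

/-- First factors for `𝔖^♭ᵀ`: `a_i + ε s_{ik} a'_k`, `s_{10} = -1`. [folklore] -/
def uF : Fin 6 → Fin 4 → List ℤ :=
  ![![[1], [], [0, 1], []], ![[1], [], [], [0, 1]], ![[], [1], [0, -1], []], ![[], [1], [], [0, 1]],
    ![[-1], [], [], []], ![[], [-1], [], []]]

/-- Second factors: `X_{ik}` (`ρ = 2i+k`), `X_{i0} + X_{i1}` (`ρ = 4+i`). [folklore] -/
def vT : Fin 6 → Fin 4 → List ℤ :=
  ![![[1], [], [], []], ![[], [1], [], []], ![[], [], [1], []], ![[], [], [], [1]],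
    ![[1], [1], [], []], ![[], [], [1], [1]]]

/-- Third factors: `c'_i + ε c_k` (`ρ = 2i+k`), `c'_i` (`ρ = 4+i`). [folklore] -/
def wT : Fin 6 → Fin 4 → List ℤ :=
  ![![[0, 1], [], [1], []], ![[], [0, 1], [1], []], ![[0, 1], [], [], [1]], ![[], [0, 1], [], [1]],
    ![[], [], [1], []], ![[], [], [], [1]]]

/-- **The six triads are an order-`1` approximate decomposition of `𝔖^ᵀ`** (kernel check).
[cite: Blaser2013, Def. 6.1] -/
theorem twistZ_check : ApproxCert.check 4 4 4 6 1 1 twistZ uT vT wT = true := by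
  decide +kernel

/-- **The six triads are an order-`1` approximate decomposition of `𝔖^♭ᵀ`** (kernel check).
[cite: Blaser2013, Def. 6.1] -/
theorem flatTZ_check : ApproxCert.check 4 4 4 6 1 1 flatTZ uF vT wT = true := by
  decide +kernel

/-- Projection `K⁴ → K³` of the wedged (second) factor for the Koszul certificate of `𝔖^ᵀ`.
[cite: LandsbergOttaviani2015, Thm. 2.1] -/
def kyMT : List (List ℤ) := [[1, 2, 1, 1], [1, 1, 0, 2], [1, 1, 0, 1]]

/-- Row combinations certifying rank `12` of the Koszul–Young flattening of `𝔖^ᵀ` (second factor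
wedged). [folklore] -/
def rowsT : List (List (ℕ × ℤ)) :=
  [[(0, 1)], [(1, 1)], [(2, 1)], [(2, 1), (3, -1)], [(0, 1), (1, -1), (4, -1)], [(5, 1)],
    [(2, -2), (3, 1), (6, 1)], [(6, 1), (7, -1)], [(1, -1), (5, 2), (8, -1)],
    [(0, -1), (4, 1), (8, -1), (9, -1)], [(2, 1), (3, -1), (6, -2), (7, 2), (10, -1)],
    [(2, 1), (6, -1), (11, 1)]]

/-- Pivot columns for `rowsT`. [folklore] -/
def pivT : List ℕ := [0, 4, 2, 6, 5, 1, 7, 3, 8, 9, 10, 11]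

/-- **The Koszul–Young flattening of `𝔖^ᵀ` has rank `12`, with unit pivots** (kernel check).
[cite: LandsbergOttaviani2015, Thm. 2.1] -/
theorem twistZ_ky :
    intTriCheckUnit 12 (KYCert.kyEntry 4 4 4 kyMT (fun j l i => twistZ i j l)) rowsT pivT =
      true := by
  decide +kernel

/-- Projection of the wedged (second) factor for the Koszul certificate of `𝔖^♭ᵀ`.
[cite: LandsbergOttaviani2015, Thm. 2.1] -/
def kyMF : List (List ℤ) := [[-1, 0, -1, 1], [-1, 0, -1, 0], [1, 1, 0, 0]]

/-- Row combinations certifying rank `12` of the Koszul–Young flattening of `𝔖^♭ᵀ`. [folklore] -/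
def rowsF : List (List (ℕ × ℤ)) :=
  [[(0, 1)], [(0, -1), (1, 1)], [(2, 1)], [(3, 1)], [(0, 1), (4, 1)], [(5, 1)],
    [(2, 1), (3, -1), (6, 1)], [(6, 1), (7, -1)], [(0, 1), (1, -1), (5, 1), (8, -1)],
    [(5, 1), (9, -1)], [(6, 1), (7, -1), (10, -1)], [(6, 1), (7, -1), (10, -1), (11, 1)]]

/-- Pivot columns for `rowsF`. [folklore] -/
def pivF : List ℕ := [0, 5, 2, 7, 1, 8, 3, 10, 4, 9, 6, 11]

/-- **The Koszul–Young flattening of `𝔖^♭ᵀ` has rank `12`, with unit pivots** (kernel check).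
[cite: LandsbergOttaviani2015, Thm. 2.1] -/
theorem flatTZ_ky :
    intTriCheckUnit 12 (KYCert.kyEntry 4 4 4 kyMF (fun j l i => flatTZ i j l)) rowsF pivF =
      true := by
  decide +kernel

/-! ## The integer tables ARE the twisted stars -/

/-- Leaves ↦ `Fin 4`: `inl (i,0) ↦ i`, `inr (i,0) ↦ 2 + i`. [folklore] -/
def leafIdx : Leaf2 ≃ Fin 4 where
  toFun := Sum.elim (fun z => z.1.castAdd 2) (fun z => z.1.natAdd 2)
  invFun j := if h : j.val < 2 then Sum.inl (⟨j.val, h⟩, 0) else Sum.inr (⟨j.val - 2, by omega⟩, 0)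
  left_inv := by decide
  right_inv := by decide

/-- `x = (x₁, x₂) ↦ 2x₁ + x₂`. [folklore] -/
def xIdx : (Fin 2 × Fin 2) ≃ Fin 4 where
  toFun x := ⟨2 * x.1.val + x.2.val, by omega⟩
  invFun j := (⟨j.val / 2, by omega⟩, ⟨j.val % 2, by omega⟩)
  left_inv := by decide
  right_inv := by decide

/-- The table `twistZ` is `𝔖^ᵀ` over `ℤ` (kernel check of all `64` entries). [folklore] -/
theorem twistedStar_int_eq :
    ∀ a x c, twistedStar ℤ 2 1 a x c = twistZ (leafIdx a) (xIdx x) (leafIdx c) := by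
  decide

section Field
variable (K : Type u) [Field K]

/-- `𝔖^ᵀ` over `K` is the cast of `𝔖^ᵀ` over `ℤ`. [folklore] -/
theorem twistedStar_cast (a : Leaf2) (x : Fin 2 × Fin 2) (c : Leaf2) :
    twistedStar K 2 1 a x c = ((twistedStar ℤ 2 1 a x c : ℤ) : K) := by
  rcases a with a | a <;> rcases c with c | c
  · simp only [twistedStar_inl_inl, matMulTensor]
    split_ifs <;> simp
  · simp
  · simp
  · simp only [twistedStar_inr_inr, matMulTensor]
    split_ifs <;> simp

/-- `𝔖^ᵀ = twistZ` read through the index bijections. [folklore] -/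
theorem twistedStar_eq_twistZ :
    twistedStar K 2 1 = fun a x c => ((twistZ (leafIdx a) (xIdx x) (leafIdx c) : ℤ) : K) := by
  funext a x c
  rw [twistedStar_cast, twistedStar_int_eq]

/-- Integer weights of `𝔖^♭ᵀ` (`wt` over `ℤ`, which is not a field). [folklore] -/
def wtZ : Leaf2 → Leaf2 → ℤ
  | Sum.inr z, Sum.inr w => if (w.1, z.1) = ((1 : Fin 2), (0 : Fin 2)) then -1 else 1
  | _, _ => 1

/-- The table `flatTZ` in closed form (kernel check of all `64` entries). [folklore] -/
theorem flatTZ_closed : ∀ a x c, flatTZ (leafIdx a) (xIdx x) (leafIdx c) =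
    if side a = side c ∧ x = bOf a c then wtZ a c else 0 := by
  decide

/-- `wt = wtZ` cast. [folklore] -/
theorem wt_eq_cast (a c : Leaf2) : wt K a c = ((wtZ a c : ℤ) : K) := by
  rcases a with a | a <;> rcases c with c | c
  · simp [wt, wtZ]
  · simp [wt, wtZ]
  · simp [wt, wtZ]
  · simp only [wt, wtZ, sgnWeight]
    split_ifs <;> simp

/-- `𝔖^♭ᵀ = flatTZ` read through the index bijections. [folklore] -/
theorem signTStar_eq_flatTZ :
    signTStar K = fun a x c => ((flatTZ (leafIdx a) (xIdx x) (leafIdx c) : ℤ) : K) := by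
  funext a x c
  rw [signTStar_apply, flatTZ_closed]
  split_ifs <;> simp [wt_eq_cast]

/-! ## Border rank six -/

/-- **`R̲(𝔖^ᵀ) ≤ 6` over every field**: six triads, order `1`.
[cite: Blaser2013, Def. 6.1] -/
theorem algBorderRank_twistedStar_le : algBorderRank (twistedStar K 2 1) ≤ 6 := by
  rw [twistedStar_eq_twistZ K,
    algBorderRank_reindex leafIdx xIdx leafIdx (fun i j l => ((twistZ i j l : ℤ) : K))]
  exact ApproxCert.algBorderRank_le_of_check_one K twistZ_check

/-- **`R̲(𝔖^♭ᵀ) ≤ 6` over every field**: six triads, order `1`.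
[cite: Blaser2013, Def. 6.1] -/
theorem algBorderRank_signTStar_le : algBorderRank (signTStar K) ≤ 6 := by
  rw [signTStar_eq_flatTZ K,
    algBorderRank_reindex leafIdx xIdx leafIdx (fun i j l => ((flatTZ i j l : ℤ) : K))]
  exact ApproxCert.algBorderRank_le_of_check_one K flatTZ_check

/-- **`6 ≤ R̲(𝔖^ᵀ)` over every field**: the Koszul–Young flattening with the second factor wedged
has rank `12 > 2 · 5`. [cite: LandsbergOttaviani2015, Thm. 2.1] -/
theorem six_le_algBorderRank_twistedStar : 6 ≤ algBorderRank (twistedStar K 2 1) := by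
  rw [twistedStar_eq_twistZ K,
    algBorderRank_reindex leafIdx xIdx leafIdx (fun i j l => ((twistZ i j l : ℤ) : K))]
  exact KYCert.le_algBorderRank_of_rotate₁ K twistZ
    (KYCert.le_algBorderRank_of_kyCheckUnit K kyMT (fun j l i => twistZ i j l) twistZ_ky
      (by norm_num))

/-- **`6 ≤ R̲(𝔖^♭ᵀ)` over every field.** [cite: LandsbergOttaviani2015, Thm. 2.1] -/
theorem six_le_algBorderRank_signTStar : 6 ≤ algBorderRank (signTStar K) := by
  rw [signTStar_eq_flatTZ K,
    algBorderRank_reindex leafIdx xIdx leafIdx (fun i j l => ((flatTZ i j l : ℤ) : K))]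
  exact KYCert.le_algBorderRank_of_rotate₁ K flatTZ
    (KYCert.le_algBorderRank_of_kyCheckUnit K kyMF (fun j l i => flatTZ i j l) flatTZ_ky
      (by norm_num))

/-- **`R̲(𝔖^ᵀ) = 6` over every field.** [cite: LandsbergOttaviani2015, Thm. 2.1]
[cite: Blaser2013, Def. 6.1] -/
theorem algBorderRank_twistedStar : algBorderRank (twistedStar K 2 1) = 6 :=
  le_antisymm (algBorderRank_twistedStar_le K) (six_le_algBorderRank_twistedStar K)

/-- **`R̲(𝔖^♭ᵀ) = 6` over every field.** [cite: LandsbergOttaviani2015, Thm. 2.1]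
[cite: Blaser2013, Def. 6.1] -/
theorem algBorderRank_signTStar : algBorderRank (signTStar K) = 6 :=
  le_antisymm (algBorderRank_signTStar_le K) (six_le_algBorderRank_signTStar K)

/-- Over every field the generic twists are border-no-dearer than `⟨2,2,2⟩`:
`R̲(𝔖^ᵀ) = R̲(𝔖^♭ᵀ) = 6 ≤ R̲(⟨2,2,2⟩)` (BCS Problem 15.1: the latter is `6` or `7`).
[cite: BurgisserClausenShokrollahi1997, Cor. (19.14) and Problem 15.1] -/
theorem algBorderRank_twists_le_matMul :
    algBorderRank (twistedStar K 2 1) ≤ algBorderRank (matMulTensor K 2 2 2) ∧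
      algBorderRank (signTStar K) ≤ algBorderRank (matMulTensor K 2 2 2) :=
  ⟨(algBorderRank_twistedStar K).trans_le (six_le_algBorderRank_matMulTensor_two_allFields K),
    (algBorderRank_signTStar K).trans_le (six_le_algBorderRank_matMulTensor_two_allFields K)⟩

end Field

/-- **Over `ℂ` the generic twists are STRICTLY border-cheaper than `⟨2,2,2⟩`**:
`R̲(𝔖^ᵀ) = R̲(𝔖^♭ᵀ) = 6 < 7 = R̲(⟨2,2,2⟩)`, the last equality being Landsberg's theorem (named
fact `Landsberg2005_borderRank_matMulTensor_two`). [cite: Landsberg2005, main theorem (p. 447)] -/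
theorem algBorderRank_twists_lt_matMul (h : Landsberg2005_borderRank_matMulTensor_two) :
    algBorderRank (twistedStar ℂ 2 1) < algBorderRank (matMulTensor ℂ 2 2 2) ∧
      algBorderRank (signTStar ℂ) < algBorderRank (matMulTensor ℂ 2 2 2) := by
  have h7 : algBorderRank (matMulTensor ℂ 2 2 2) = 7 := h
  rw [h7, algBorderRank_twistedStar, algBorderRank_signTStar]
  norm_num

end Summit.MatrixMultiplication.MatrixMultiplication.Theorems.FarEdgeDescentTwistBorderRank

end
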